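import Summits.ResolutionOfSingularities.ResolutionOfSingularities.Theses.RadicialJung
import Summits.ResolutionOfSingularities.ResolutionOfSingularities.Theorems.RadicialJungCleanModelsT2CleanModelsDimLETwoOverField
import Summits.ResolutionOfSingularities.ResolutionOfSingularities.Theorems.RadicialJungCleanModelsReductionAt
import Summits.ResolutionOfSingularities.ResolutionOfSingularities.Theorems.RadicialJungCleanModelsStubStacks0BICLocus
import Summits.ResolutionOfSingularities.ResolutionOfSingularities.Theorems.RadicialJungCleanModelsCleanPatchingDefs
import Summits.ResolutionOfSingularities.ResolutionOfSingularities.Theorems.RadicialJungCleanModelsStubCleanCharts3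
import Summits.ResolutionOfSingularities.ResolutionOfSingularities.Theorems.RadicialJungCleanModelsStubCleanTwoModelPatching3
import Summits.ResolutionOfSingularities.ResolutionOfSingularities.Theorems.RadicialJungCleanModelsStubCleanGlobalization3
import Summits.ResolutionOfSingularities.ResolutionOfSingularities.Theorems.RadicialJungCleanModelsStubCleanPointBlowup
import Summits.ResolutionOfSingularities.ResolutionOfSingularities.Theorems.RadicialJungCleanModelsCleanPrincipalizationOfProp44
import Summits.ResolutionOfSingularities.ResolutionOfSingularities.Theorems.RadicialJungCleanModelsCleanCharts3ZeroDim
import Summits.ResolutionOfSingularities.ResolutionOfSingularities.Theorems.RadicialJungCleanModelsCleanLU3ArcDiscrete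
import Summits.ResolutionOfSingularities.ResolutionOfSingularities.Theorems.RadicialJungCleanModelsCleanLU3DefectlessOfThm11
import Summits.ResolutionOfSingularities.ResolutionOfSingularities.Theorems.RadicialJungCleanModelsCleanLU3CompositeCdivCPOfThm11
import Summits.ResolutionOfSingularities.ResolutionOfSingularities.Theorems.RadicialJungCleanModelsLens5PRankTwoPort5OfThm11
import Summits.ResolutionOfSingularities.ResolutionOfSingularities.Theorems.RadicialJungCleanModelsLens5TFramePDegreeC
import Summits.ResolutionOfSingularities.ResolutionOfSingularities.Theorems.RadicialJungCleanModelsLens5TFramePMonOfThm11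
import Summits.ResolutionOfSingularities.ResolutionOfSingularities.Theorems.RadicialJungCleanModelsLens5TFrameSepConst
import Summits.ResolutionOfSingularities.ResolutionOfSingularities.Theorems.RadicialJungCleanModelsLens5TFrameCompositionInfOfThm11
import Summits.ResolutionOfSingularities.ResolutionOfSingularities.Theorems.RadicialJungCleanModelsLens5PTwoPhase
import Summits.ResolutionOfSingularities.ResolutionOfSingularities.Theorems.RadicialJungCleanModelsLens5PTwoSlice
import Summits.ResolutionOfSingularities.ResolutionOfSingularities.Theorems.RadicialJungCleanModelsLens5KbarCossart
import Summits.ResolutionOfSingularities.ResolutionOfSingularities.Theorems.RadicialJungCleanModelsCcurveMainGen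
import Summits.ResolutionOfSingularities.ResolutionOfSingularities.Theorems.RadicialJungCleanModelsConeExitSmooth
import Summits.ResolutionOfSingularities.ResolutionOfSingularities.Theorems.RadicialJungCleanModelsKbarLUOfCossartRational
import Summits.ResolutionOfSingularities.ResolutionOfSingularities.Theorems.RadicialJungCleanModelsKbarQuasiProjectiveModel
import Literature.AlgebraicGeometry.Resolution.CossartFunctionNormalForm3
import Literature.AlgebraicGeometry.Resolution.TranscendenceDefect
import Literature.AlgebraicGeometry.Resolution.LocalBlowup
import Literature.AlgebraicGeometry.Resolution.ExcellentRings
import Literature.AlgebraicGeometry.Resolution.ExcellentRingsFieldProofs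
import Literature.AlgebraicGeometry.CossartPiltant200819.Thm15iBaseSidePhase2019
import Literature.AlgebraicGeometry.CossartPiltant200819.GoodResolution2019
import Literature.AlgebraicGeometry.CossartPiltant200819.GoodResolutionReduced2019
import HarnessLib

/-!
# `RadicialJung.CleanModels` from SIX inputs — Cossart 1987 replaced by its RATIONAL twin (Posva 2024 Claim 5.1.2), the `k = k̄` slice of `dim ≤ 3` closed at the TOP

Crux `stmt-ResolutionOfSingularities-15917` (`Summit.….Theses.RadicialJung.CleanModels`), registered skeleton `Cruxes/CleanModels/Lines/Sketch.lean` rev 35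
(sha16 de44649d8f729c3b); candidate reshapes `Lines/Sketch_hand1_thm11.lean` (decomp-res-hand-1 g0) and `Lines/Sketch_hand1_g23_kbar1.lean` (g23), MERGED here.
Twin of `RadicialJungCleanModelsOfInputsThm11.lean` (g0: SIX inputs, printed = `CP2019.CossartPiltant2019Thm11`, F-112 `Cossart1987Thm`, wi-91399 at `p = 2`).
Kernel-checked, NO `sorry`, NO new definition: the SAME composition as the twin, EXCEPT (1) F-112 `Cossart1987Thm` (Cossart 1987 for a GLOBAL function,
`k = k̄`) is REPLACED by `Cossart1987ThmRational` (Cossart 1987 for a RATIONAL function = Posva 2024 Claim 5.1.2 / App. A §A.7, the SAME source;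
`Literature/…/Resolution/CossartFunctionNormalForm3.lean`), consumed in the class-(B) node through ✓ `KbarRational.cleanLU3DefectNonDiscrete_algClosed_of_cossartRational`
(decomp-res-hand-1 g22); (2) the `dim W ≤ 3` node OPENS with `by_cases IsAlgClosed k`, the closed case being ONE `exact` on ✓
`KbarQuasiProjective.cleanModels_algClosed_dimLEThree_of_cossartRational` (g23: Chow + Stacks 081T + the tree's PROVED Cossart–Piltant principalization give a
regular quasi-projective model of EVERY regular threefold; then Cossart/Posva and the closed-point read-off) — over `k̄` NO local uniformization, NO patching.

* `cleanLU3DefectNonDiscrete_of_inputs`, `cleanLU3_of_inputs`, `cleanModels_dimLEThree_of_inputs`, `cleanModels_of_inputs` — the twin's four nodes with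
  `hCR : Cossart1987ThmRational` for `h112 : Cossart1987Thm`; `hB` (= `stub_cleanLU3DefectNonDiscrete` rev 35), `hBS2` (= `stub_cp2019Thm15iBaseSidePhaseTwo`),
  `h44c` (= `stub_cleanProp44`), `hGE4` (= `stub_cleanModelsDimGEFour`) VERBATIM and unchanged;
* `cleanModels_of_namedInputs` — `hBS2` supplied by the general-`p` NAMED fact wi-91399 (✓ `Lens5.PTwo.baseSidePhaseTwo_of_cp2019`);
* `cleanModels_algClosed_of_inputs` — over an ALGEBRAICALLY CLOSED ground field the crux (every dimension) from `hCR` and the frontier `hGE4` ALONE.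
(The twin's book-keeping `cleanModels_of_general_cjs_inputs` — the printed base did not grow, ✓ `CP2019.thm11_of_general` — applies verbatim.)

INPUT LEDGER BY CELL (kernel-checked here and in the cited files): `dim W ≤ 2` — nothing (F-75c ✓); `dim 3`, `k = k̄` — `Cossart1987ThmRational` ALONE;
`dim 3`, `k ≠ k̄`, `p = 2` — wi-91399 at `2` + X44c (the `by_cases p = 2` of `cleanLU3_of_inputs` precedes every use of `h11`, `hB`); `dim 3`, `k ≠ k̄`, `p` odd —
`CP2019.CossartPiltant2019Thm11` + class (B) + X44c; `dim ≥ 4` — `hGE4`.  PRINTED = {CP 2019 Thm. 1.1 (i)(ii)(iii) verbatim, Cossart 1987 / Posva 2024 Claim 5.1.2,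
CP 2019 Thm. 1.5 (i) at `p = 2`}; RESEARCH (OURS) = {class (B), X44c}, now serving NON-algebraically-closed ground fields only; FRONTIER = `dim W ≥ 4`.  Honest
framing: a CONDITIONAL packaging (re-accounting of NAMED inputs); nothing here proves resolution of singularities in characteristic `p`.
-/

noncomputable section

set_option linter.dupNamespace false

open CategoryTheory AlgebraicGeometry
open Literature.AlgebraicGeometry.Resolution Literature.AlgebraicGeometry.Motives
open Literature.AlgebraicGeometry.CossartPiltant200819

namespace Summit.ResolutionOfSingularities.ResolutionOfSingularities.Theorems.RadicialJung.CleanModels.OfInputsRational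

section Inputs

variable
  -- The two PRINTED named facts `h11 : CP2019.CossartPiltant2019Thm11` (CP 2019 Thm. 1.1 verbatim) and `hCR : Cossart1987ThmRational` (Cossart 1987 for a
  -- RATIONAL function = Posva 2024 Claim 5.1.2, `k = k̄`) are EXPLICIT binders of each theorem below; the four statements of ours are section variables.
  -- PRINTED wi-91399 AT `p = 2`: `stub_cp2019Thm15iBaseSidePhaseTwo` of Sketch rev 33–35, VERBATIM. [cite: CossartPiltant2019, Thm. 1.5 (i)]
  (hBS2 :
    ∀ (S : Type) [CommRing S] [IsRegularLocalRing S],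
      IsExcellentRing S → ringKrullDim S = 3 → CharP S 2 →
      ∀ (K : Type) [Field K] [Algebra S K] [IsFractionRing S K] (f : S),
      (∀ c : K, c ^ 2 ≠ algebraMap S K f) →
      ∀ (O : ValuationSubring K), (algebraMap S K).range ≤ O.toSubring →
      (∀ s ∈ IsLocalRing.maximalIdeal S, O.valuation (algebraMap S K s) < 1) →
      ∃ (n : ℕ) (B : ℕ → Subring K) (g : ℕ → K),
      B 0 = locAtCentre (algebraMap S K).range O ∧ g 0 = algebraMap S K f ∧
      (∀ i ≤ n, B i ≤ O.toSubring ∧ IsRegularLocalRing (B i) ∧ g i ∈ B i) ∧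
      (∀ i < n, ∃ P : Ideal (B i), IsRegularLocalRing ((B i) ⧸ P) ∧
        IsLocalBlowupAlong O (B i) P (B (i + 1)) ∧
        ∃ c d : K, c ≠ 0 ∧ g (i + 1) = c ^ 2 * g i + d ^ 2) ∧
      ∀ (hg : g n ∈ B n) (_hBn : IsRegularLocalRing (B n)) (c : B n),
        (⟨g n, hg⟩ : B n) - c ^ 2 ∉ IsLocalRing.maximalIdeal (B n) ^ 2)
  -- RESEARCH (OURS), class (B): `stub_cleanLU3DefectNonDiscrete` of Sketch rev 35, VERBATIM.
  (hB :
    ∀ (p : ℕ), p.Prime → p ≠ 2 →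
    ∀ (k : Type) [Field k] [CharP k p] (K : Type) [Field K] [Algebra k K]
    (O : ValuationSubring K) (A : Subalgebra k K), A.toSubring ≤ O.toSubring → A.FG → IsFractionRing A K →
    ringKrullDim A ≤ 3 → IsRegularLocalRing (locAtCentre A.toSubring O) →
    ringKrullDim (locAtCentre A.toSubring O) = 3 →
    (∀ (T : Subring K) (hT : T ≤ O.toSubring), A.toSubring ≤ T → (subringCentre T O hT).IsMaximal) →
    ∀ g₀ : K, (∀ c : K, c ^ p ≠ g₀) →
    (∀ f₀ : K, ∃ f₁ : K, O.valuation (g₀ - f₁ ^ p) < O.valuation (g₀ - f₀ ^ p)) →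
    (∀ hk : ∀ c : k, algebraMap k K c ∈ O, transcendenceDefect k O hk ≠ 0) →
    ¬ (∃ π : K, π ≠ 0 ∧ (∀ x : K, O.valuation x < 1 → O.valuation x ≤ O.valuation π) ∧
      (∀ x : K, x ≠ 0 → ∃ n : ℕ, O.valuation π ^ n ≤ O.valuation x)) →
    ¬ (∃ (O₁ : ValuationSubring K), O ≤ O₁ ∧ O₁ ≠ ⊤ ∧ ∃ y : Fin 2 → K, (∀ i, y i ∈ O) ∧
      ∀ P : MvPolynomial (Fin 2) k, P ≠ 0 → O₁.valuation (MvPolynomial.aeval y P) = 1) →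
    ¬ ((∃ x y : K, x ≠ 0 ∧ y ≠ 0 ∧ ∀ a b : ℕ, a < p → b < p → (a ≠ 0 ∨ b ≠ 0) →
        ∀ z : K, z ≠ 0 → O.valuation (x ^ a * y ^ b) ≠ O.valuation (z ^ p)) ∧
      ∃ r : ℕ, Module.finrank (Subfield.closure (Set.range (fun x : k => x ^ p))) k = p ^ r ∧
        Module.finrank (Subfield.closure (Set.range (fun x : IsLocalRing.ResidueField O => x ^ p))) (IsLocalRing.ResidueField O) = p ^ r) →
    ¬ ((∃ x y : K, x ≠ 0 ∧ y ≠ 0 ∧ ∀ a b : ℕ, a < p → b < p → (a ≠ 0 ∨ b ≠ 0) →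
        ∀ z : K, z ≠ 0 → O.valuation (x ^ a * y ^ b) ≠ O.valuation (z ^ p)) ∧
      ∃ k' : IntermediateField k K, FiniteDimensional k k' ∧
        (∃ (n : ℕ) (s : Fin n → K), AlgebraicIndependent k' s ∧ Algebra.IsSeparable (IntermediateField.adjoin k' (Set.range s)) K) ∧
        ∃ _ : Algebra k' (IsLocalRing.ResidueField O),
          (∀ (c : k') (h : algebraMap k' K c ∈ O),
            algebraMap k' (IsLocalRing.ResidueField O) c = IsLocalRing.residue O ⟨algebraMap k' K c, h⟩) ∧
          Algebra.IsSeparable k' (IsLocalRing.ResidueField O)) →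
    ¬ IsAlgClosed k →
    ¬ (∃ O₁ : ValuationSubring K, O ≤ O₁ ∧ O₁ ≠ O ∧ O₁ ≠ ⊤) →
    ¬ (∃ (A' : Subalgebra k K) (_ : A'.toSubring ≤ O.toSubring) (_ : A ≤ A') (_ : A'.FG)
        (_ : IsRegularLocalRing (locAtCentre A'.toSubring O)) (c : Fin p → K) (_ : ∃ j : Fin p, (j : ℕ) ≠ 0 ∧ c j ≠ 0)
        (h : ↥(locAtCentre A'.toSubring O)) (_ : (∑ j : Fin p, c j ^ p * g₀ ^ (j : ℕ)) = (h : K))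
        (d : ℕ) (_ : 0 < d) (_ : (IsLocalRing.maximalIdeal ↥(locAtCentre A'.toSubring O)).spanFinrank = d)
        (t : Fin d → ↥(locAtCentre A'.toSubring O)) (_ : Ideal.span (Set.range t) = IsLocalRing.maximalIdeal ↥(locAtCentre A'.toSubring O))
        (F : MvPolynomial (Fin d) ↥(locAtCentre A'.toSubring O)) (e N : ℕ) (_ : F.IsHomogeneous e) (_ : ¬ p ∣ e) (_ : e ≤ N + 1),
        h - MvPolynomial.aeval t F ∈ IsLocalRing.maximalIdeal ↥(locAtCentre A'.toSubring O) ^ (e + 1) ∧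
        ∀ i, ∃ b : Fin d → ↥(locAtCentre A'.toSubring O),
          (∀ l, b l ∈ IsLocalRing.maximalIdeal ↥(locAtCentre A'.toSubring O) ^ (N + 1 - e)) ∧
          t i ^ N - ∑ l, b l * MvPolynomial.aeval t (MvPolynomial.pderiv l F) ∈
            IsLocalRing.maximalIdeal ↥(locAtCentre A'.toSubring O) ^ (N + 1)) →
    ∃ (A' : Subalgebra k K), A'.toSubring ≤ O.toSubring ∧ A ≤ A' ∧ A'.FG ∧
    ∃ (_ : IsRegularLocalRing (locAtCentre A'.toSubring O)) (c : Fin p → K), (∃ j : Fin p, (j : ℕ) ≠ 0 ∧ c j ≠ 0) ∧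
    ((∃ (d m : ℕ) (hmd : m ≤ d) (t : Fin d → ↥(locAtCentre A'.toSubring O)) (a : Fin m → ℕ) (u : ↥(locAtCentre A'.toSubring O)), IsUnit u ∧
    Ideal.span (Set.range t) = IsLocalRing.maximalIdeal ↥(locAtCentre A'.toSubring O) ∧
    ringKrullDim ↥(locAtCentre A'.toSubring O) = (d : WithBot ℕ∞) ∧ 0 < m ∧ (∀ i, ¬ p ∣ a i) ∧
    (∑ j : Fin p, c j ^ p * g₀ ^ (j : ℕ)) = (u : K) * ∏ i : Fin m, ((t (Fin.castLE hmd i) : ↥(locAtCentre A'.toSubring O)) : K) ^ (a i)) ∨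
    (∃ u : ↥(locAtCentre A'.toSubring O), IsUnit u ∧ (∑ j : Fin p, c j ^ p * g₀ ^ (j : ℕ)) = (u : K) ∧
    ∀ c' : ↥(locAtCentre A'.toSubring O), u - c' ^ p ∉ IsLocalRing.maximalIdeal ↥(locAtCentre A'.toSubring O)) ∨
    (∃ s c' : ↥(locAtCentre A'.toSubring O), (∑ j : Fin p, c j ^ p * g₀ ^ (j : ℕ)) = (s : K) ∧
    s - c' ^ p ∈ IsLocalRing.maximalIdeal ↥(locAtCentre A'.toSubring O) ∧
    s - c' ^ p ∉ IsLocalRing.maximalIdeal ↥(locAtCentre A'.toSubring O) ^ 2)))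
  (h44c :
    ∀ (p : ℕ), p.Prime → ∀ (S : Scheme.{0}) [IsIntegral S] [IsNoetherian S],
      CharP S.functionField p → Scheme.IsRegular S → Scheme.IsExcellent S → topologicalKrullDim S = 3 →
      ∀ G₀ : S.functionField, (∀ s : S, CleanRegAt p (algebraMap (S.presheaf.stalk s) S.functionField) G₀) →
      ∀ I : S.IdealSheafData, I ≠ ⊥ →
      ∀ (X : Scheme.{0}) (ρ : X ⟶ S) [IsIntegral X] [IsNoetherian X] [IsDominant ρ],
        IsCleanRegularCentreBlowupSeq p ρ I G₀ →
        (∀ x : X, CleanRegAt p (algebraMap (X.presheaf.stalk x) X.functionField) (RatFn.functionFieldMap ρ G₀)) →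
        ∀ (J : X.IdealSheafData) (μ : ℕ), 1 ≤ μ →
          (∀ x ∈ J.support, 1 < Order.coheight x) → (∀ x, idealOrder J x ≤ μ) → (∃ x, idealOrder J x = μ) →
          ∃ (X' : Scheme.{0}) (π : X' ⟶ X) (_ : IsIntegral X') (_ : IsDominant π) (J' : X'.IdealSheafData),
            IsCleanPermissibleSeq p π J μ J' (RatFn.functionFieldMap ρ G₀) ∧ ∀ x, idealOrder J' x < μ)
  -- FRONTIER (rung-B PRICE): `stub_cleanModelsDimGEFour`, VERBATIM (`dim W ≥ 4`).
  (hGE4 : ∀ p : ℕ, p.Prime → ∀ (k : Type) [Field k] [CharP k p] (W : AlgebraicGeometry.Scheme.{0}) [AlgebraicGeometry.IsIntegral W]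
      (f : W ⟶ AlgebraicGeometry.Spec (.of k)) (L : Type) [Field L] [Algebra W.functionField L], AlgebraicGeometry.IsSeparated f →
      AlgebraicGeometry.LocallyOfFiniteType f → AlgebraicGeometry.QuasiCompact f → Literature.AlgebraicGeometry.Resolution.Scheme.IsRegular W →
      IsPurelyInseparable W.functionField L → Module.finrank W.functionField L = p → ¬ topologicalKrullDim W ≤ 3 →
      ∃ (V : AlgebraicGeometry.Scheme.{0}) (π : V ⟶ W) (_ : AlgebraicGeometry.IsIntegral V) (_ : AlgebraicGeometry.IsDominant π), AlgebraicGeometry.IsProper π ∧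
      Literature.AlgebraicGeometry.Resolution.IsBirational π ∧ Literature.AlgebraicGeometry.Resolution.Scheme.IsRegular V ∧ (∀ v : V, (∃ (y : L) (g : W.functionField),
      y ∉ Set.range (algebraMap W.functionField L) ∧ algebraMap W.functionField L g = y ^ p ∧ ((∃ (d m : ℕ) (hmd : m ≤ d) (t : Fin d → V.presheaf.stalk v) (a : Fin m → ℕ),
      Ideal.span (Set.range t) = IsLocalRing.maximalIdeal (V.presheaf.stalk v) ∧ ringKrullDim (V.presheaf.stalk v) = (d : WithBot ℕ∞) ∧ 0 < m ∧ (∀ i, ¬ p ∣ a i) ∧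
      Literature.AlgebraicGeometry.Motives.RatFn.functionFieldMap π g = ∏ i : Fin m, (algebraMap (V.presheaf.stalk v) V.functionField (t (Fin.castLE hmd i))) ^ (a i)) ∨
      (∃ u₀ : V.presheaf.stalk v, IsUnit u₀ ∧ Literature.AlgebraicGeometry.Motives.RatFn.functionFieldMap π g = algebraMap (V.presheaf.stalk v) V.functionField u₀ ∧
      ((∀ c : V.presheaf.stalk v, u₀ - c ^ p ∉ IsLocalRing.maximalIdeal (V.presheaf.stalk v)) ∨ (∃ c : V.presheaf.stalk v,
      u₀ - c ^ p ∈ IsLocalRing.maximalIdeal (V.presheaf.stalk v) ∧ u₀ - c ^ p ∉ IsLocalRing.maximalIdeal (V.presheaf.stalk v) ^ 2)))))))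

include hB in
/-- The rev-20/24 node «clean LU at ZERO-DIMENSIONAL, NON-ABHYANKAR valuations where the line of `g₀` is IMMEDIATE and `O` is NOT discrete of
rank one», for ODD `p`, from the printed facts `CP2019.CossartPiltant2019Thm11` / `Cossart1987ThmRational` and the class-(B) research statement `hB`
(rev 35), by excluded middle on «divisorial coarsening» ((C-div) slice, ✓ `cleanLU3Defect_of_divisorialCoarsening_cp_thm11`), «`k` perfect and
`[Γ:pΓ] = p²`» (THEOREM T, ✓ `…cleanLU3DefectPRankTwo_of_cossartPiltant2019_thm11`), «`[Γ:pΓ] = p²` and equal finite `p`-degrees» (T⁗‴), «`[Γ:pΓ] = p²`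
and separable constants» (T″/T‴), «`k` algebraically closed» (✓ `KbarRational.cleanLU3DefectNonDiscrete_algClosed_of_cossartRational`, the RATIONAL twin — the one
change w.r.t. the twin file), «proper coarsening» (composite slice), «a smooth-cone stage exists» (✓ `ConeExit.cleanLUConcl_of_smoothCone`).  F-02 is derived:
`CP2019.CossartPiltant2019Thm11.cossartPiltant2019 h11 Stacks07QW_field_holds`. [cite: CossartPiltant2019, Thm. 1.1] [cite: Posva2024, Claim 5.1.2 and App. A §A.7] -/
theorem cleanLU3DefectNonDiscrete_of_inputs (h11 : CP2019.CossartPiltant2019Thm11.{0}) (hCR : Cossart1987ThmRational) :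
    ∀ (p : ℕ), p.Prime → p ≠ 2 →
    ∀ (k : Type) [Field k] [CharP k p] (K : Type) [Field K] [Algebra k K]
    (O : ValuationSubring K) (A : Subalgebra k K), A.toSubring ≤ O.toSubring → A.FG → IsFractionRing A K →
    ringKrullDim A ≤ 3 → IsRegularLocalRing (locAtCentre A.toSubring O) →
    ringKrullDim (locAtCentre A.toSubring O) = 3 →
    (∀ (T : Subring K) (hT : T ≤ O.toSubring), A.toSubring ≤ T → (subringCentre T O hT).IsMaximal) →
    ∀ g₀ : K, (∀ c : K, c ^ p ≠ g₀) →
    (∀ f₀ : K, ∃ f₁ : K, O.valuation (g₀ - f₁ ^ p) < O.valuation (g₀ - f₀ ^ p)) →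
    (∀ hk : ∀ c : k, algebraMap k K c ∈ O, transcendenceDefect k O hk ≠ 0) →
    ¬ (∃ π : K, π ≠ 0 ∧ (∀ x : K, O.valuation x < 1 → O.valuation x ≤ O.valuation π) ∧
      (∀ x : K, x ≠ 0 → ∃ n : ℕ, O.valuation π ^ n ≤ O.valuation x)) →
    ∃ (A' : Subalgebra k K), A'.toSubring ≤ O.toSubring ∧ A ≤ A' ∧ A'.FG ∧
    ∃ (_ : IsRegularLocalRing (locAtCentre A'.toSubring O)) (c : Fin p → K), (∃ j : Fin p, (j : ℕ) ≠ 0 ∧ c j ≠ 0) ∧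
    ((∃ (d m : ℕ) (hmd : m ≤ d) (t : Fin d → ↥(locAtCentre A'.toSubring O)) (a : Fin m → ℕ) (u : ↥(locAtCentre A'.toSubring O)), IsUnit u ∧
    Ideal.span (Set.range t) = IsLocalRing.maximalIdeal ↥(locAtCentre A'.toSubring O) ∧
    ringKrullDim ↥(locAtCentre A'.toSubring O) = (d : WithBot ℕ∞) ∧ 0 < m ∧ (∀ i, ¬ p ∣ a i) ∧
    (∑ j : Fin p, c j ^ p * g₀ ^ (j : ℕ)) = (u : K) * ∏ i : Fin m, ((t (Fin.castLE hmd i) : ↥(locAtCentre A'.toSubring O)) : K) ^ (a i)) ∨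
    (∃ u : ↥(locAtCentre A'.toSubring O), IsUnit u ∧ (∑ j : Fin p, c j ^ p * g₀ ^ (j : ℕ)) = (u : K) ∧
    ∀ c' : ↥(locAtCentre A'.toSubring O), u - c' ^ p ∉ IsLocalRing.maximalIdeal ↥(locAtCentre A'.toSubring O)) ∨
    (∃ s c' : ↥(locAtCentre A'.toSubring O), (∑ j : Fin p, c j ^ p * g₀ ^ (j : ℕ)) = (s : K) ∧
    s - c' ^ p ∈ IsLocalRing.maximalIdeal ↥(locAtCentre A'.toSubring O) ∧
    s - c' ^ p ∉ IsLocalRing.maximalIdeal ↥(locAtCentre A'.toSubring O) ^ 2)) := by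
  intro p hp hp2 k _ _ K _ _ O A hAO hAfg hfrac hdimA hreg hdim3 hzd g₀ hg₀ hdefect htd hdisc
  have h02 : CossartPiltant2019.{0} := CP2019.CossartPiltant2019Thm11.cossartPiltant2019 h11 Stacks07QW_field_holds
  by_cases hdiv : ∃ (O₁ : ValuationSubring K), O ≤ O₁ ∧ O₁ ≠ ⊤ ∧ ∃ y : Fin 2 → K, (∀ i, y i ∈ O) ∧
      ∀ P : MvPolynomial (Fin 2) k, P ≠ 0 → O₁.valuation (MvPolynomial.aeval y P) = 1
  · obtain ⟨O₁, hOO₁, hO₁, y, hy, hind⟩ := hdiv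
    exact cleanLU3Defect_of_divisorialCoarsening_cp_thm11 h11 h02 p hp k K O A hAO hAfg hfrac hdim3 hzd
      g₀ hg₀ hdefect O₁ hOO₁ hO₁ y hy hind
  · by_cases hT : PerfectField k ∧ ∃ x y : K, x ≠ 0 ∧ y ≠ 0 ∧ ∀ a b : ℕ, a < p → b < p → (a ≠ 0 ∨ b ≠ 0) →
        ∀ z : K, z ≠ 0 → O.valuation (x ^ a * y ^ b) ≠ O.valuation (z ^ p)
    · obtain ⟨hperf, hP2⟩ := hT
      haveI := hperf
      haveI : Fact p.Prime := ⟨hp⟩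
      exact Lens5.PRankTwoAssembly.cleanLU3DefectPRankTwo_of_cossartPiltant2019_thm11 p h02 h11
        k K O A hAO hAfg hfrac hdimA hreg hdim3 hzd g₀ hg₀ hdefect htd hdisc hP2
    · by_cases hT4 : (∃ x y : K, x ≠ 0 ∧ y ≠ 0 ∧ ∀ a b : ℕ, a < p → b < p → (a ≠ 0 ∨ b ≠ 0) →
          ∀ z : K, z ≠ 0 → O.valuation (x ^ a * y ^ b) ≠ O.valuation (z ^ p)) ∧
        ∃ r : ℕ, Module.finrank (Subfield.closure (Set.range (fun x : k => x ^ p))) k = p ^ r ∧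
          Module.finrank (Subfield.closure (Set.range (fun x : IsLocalRing.ResidueField O => x ^ p))) (IsLocalRing.ResidueField O) = p ^ r
      · obtain ⟨hP2, r, hk, hκ⟩ := hT4
        haveI : Fact p.Prime := ⟨hp⟩
        exact Summit.ResolutionOfSingularities.ResolutionOfSingularities.Theorems.RadicialJungCleanModels.Lens5TFrame.cleanLU3DefectPRankTwoPDeg_of_pMon p
          (Summit.ResolutionOfSingularities.ResolutionOfSingularities.Theorems.RadicialJungCleanModels.Lens5TFrame.cleanLU3DefectPRankTwoPMon_of_cossartPiltant2019_thm11
            p h02 h11)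
          k K O A hAO hAfg hfrac hdimA hreg hdim3 hzd g₀ hg₀ hdefect htd hdisc hP2 r hk hκ
      · by_cases hT6 : (∃ x y : K, x ≠ 0 ∧ y ≠ 0 ∧ ∀ a b : ℕ, a < p → b < p → (a ≠ 0 ∨ b ≠ 0) →
            ∀ z : K, z ≠ 0 → O.valuation (x ^ a * y ^ b) ≠ O.valuation (z ^ p)) ∧
          ∃ k' : IntermediateField k K, FiniteDimensional k k' ∧
            (∃ (n : ℕ) (s : Fin n → K), AlgebraicIndependent k' s ∧ Algebra.IsSeparable (IntermediateField.adjoin k' (Set.range s)) K) ∧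
            ∃ _ : Algebra k' (IsLocalRing.ResidueField O),
              (∀ (c : k') (h : algebraMap k' K c ∈ O),
                algebraMap k' (IsLocalRing.ResidueField O) c = IsLocalRing.residue O ⟨algebraMap k' K c, h⟩) ∧
              Algebra.IsSeparable k' (IsLocalRing.ResidueField O)
        · haveI : Fact p.Prime := ⟨hp⟩
          exact Summit.ResolutionOfSingularities.ResolutionOfSingularities.Theorems.RadicialJungCleanModels.Lens5TFrame.cleanLUConcl_of_sepConst p
            (Summit.ResolutionOfSingularities.ResolutionOfSingularities.Theorems.RadicialJungCleanModels.Lens5TFrame.cleanLU3DefectPRankTwoSepConst_of_cossartPiltant2019 p h02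
              (Summit.ResolutionOfSingularities.ResolutionOfSingularities.Theorems.RadicialJungCleanModels.Lens5TFrame.cleanLU3DefectPRankTwoSepRes_of_cossartPiltant2019_thm11 p h02
                h11))
            k K O A hAO hAfg hfrac hdimA hreg hdim3 hzd g₀ hg₀ hdefect htd hdisc hT6
        · by_cases halg : IsAlgClosed k
          · exact KbarRational.cleanLU3DefectNonDiscrete_algClosed_of_cossartRational p hCR hp k K O A hAO hAfg
              hfrac hdimA hreg hdim3 hzd g₀ hg₀ hdefect htd hdisc hdiv hT
          · by_cases hCc : ∃ O₁ : ValuationSubring K, O ≤ O₁ ∧ O₁ ≠ O ∧ O₁ ≠ ⊤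
            · obtain ⟨O₁, hOO₁, hne, hO₁⟩ := hCc
              exact Ccurve.cleanLU3Defect_of_properCoarsening h02 p hp k K O A hAO hAfg hfrac hdimA hreg hdim3 hzd
                g₀ hg₀ hdiv O₁ hOO₁ hne hO₁
            · by_cases hSmooth : ∃ (A' : Subalgebra k K) (_ : A'.toSubring ≤ O.toSubring) (_ : A ≤ A') (_ : A'.FG)
                  (_ : IsRegularLocalRing (locAtCentre A'.toSubring O)) (c : Fin p → K) (_ : ∃ j : Fin p, (j : ℕ) ≠ 0 ∧ c j ≠ 0)
                  (h : ↥(locAtCentre A'.toSubring O)) (_ : (∑ j : Fin p, c j ^ p * g₀ ^ (j : ℕ)) = (h : K))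
                  (d : ℕ) (_ : 0 < d) (_ : (IsLocalRing.maximalIdeal ↥(locAtCentre A'.toSubring O)).spanFinrank = d)
                  (t : Fin d → ↥(locAtCentre A'.toSubring O))
                  (_ : Ideal.span (Set.range t) = IsLocalRing.maximalIdeal ↥(locAtCentre A'.toSubring O))
                  (F : MvPolynomial (Fin d) ↥(locAtCentre A'.toSubring O)) (e N : ℕ) (_ : F.IsHomogeneous e) (_ : ¬ p ∣ e) (_ : e ≤ N + 1),
                  h - MvPolynomial.aeval t F ∈ IsLocalRing.maximalIdeal ↥(locAtCentre A'.toSubring O) ^ (e + 1) ∧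
                  ∀ i, ∃ b : Fin d → ↥(locAtCentre A'.toSubring O),
                    (∀ l, b l ∈ IsLocalRing.maximalIdeal ↥(locAtCentre A'.toSubring O) ^ (N + 1 - e)) ∧
                    t i ^ N - ∑ l, b l * MvPolynomial.aeval t (MvPolynomial.pderiv l F) ∈
                      IsLocalRing.maximalIdeal ↥(locAtCentre A'.toSubring O) ^ (N + 1)
              · obtain ⟨A', hA'O, hAA', hA'fg, hregA', c, hc0, h, hc, d, hd0, hd, t, ht, F, e, N, hF, hpe, hN, hQ, hsm⟩ := hSmooth
                exact ConeExit.cleanLUConcl_of_smoothCone hp O A A' hA'O hAA' hA'fg hregA' g₀ c hc0 h hc hd0 hd t ht F hF hpe hQ hN hsm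
              · exact hB p hp hp2 k K O A hAO hAfg hfrac hdimA hreg hdim3 hzd g₀ hg₀ hdefect htd hdisc hdiv hT4
                  hT6 halg hCc hSmooth

include hBS2 hB in
/-- **Clean local uniformization at ZERO-DIMENSIONAL valuation rings with a 3-dimensional regular centre** (the hypothesis `hLU` of the landed
4a variant ✓ `cleanCharts3_of_cleanLU3ZeroDim`), every prime `p`: `p = 2` from the registered printed stub `hBS2` ALONE (✓
`Lens5.PTwo.cleanLU3_of_eq_two_of_phaseTwo`); for odd `p`, excluded middle on «best `p`-th-power approximation» (defectless half ✓
`cleanLU3_of_isMin_pthPowerApprox_of_thm11`), «transcendence defect `= 0`» (Abhyankar, ✓ `cleanLU3_of_transcendenceDefect_eq_zero_of_thm11`),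
«discrete rank one» (class (A), ✓ `cleanLU3DefectArc_of_discrete`), then the previous theorem.  Composition identical to
`cleanLU3_of_stubs ∘ cleanLU3Defect_of_stubs` of `Lines/Sketch_hand1_thm11.lean`. [cite: CossartPiltant2019, Thm. 1.1 and Thm. 1.5 (i)] -/
theorem cleanLU3_of_inputs (h11 : CP2019.CossartPiltant2019Thm11.{0}) (hCR : Cossart1987ThmRational) :
    ∀ (p : ℕ), p.Prime →
    ∀ (k : Type) [Field k] [CharP k p] (K : Type) [Field K] [Algebra k K]
    (O : ValuationSubring K) (A : Subalgebra k K), A.toSubring ≤ O.toSubring → A.FG → IsFractionRing A K →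
    ringKrullDim A ≤ 3 → IsRegularLocalRing (locAtCentre A.toSubring O) →
    ringKrullDim (locAtCentre A.toSubring O) = 3 →
    (∀ (T : Subring K) (hT : T ≤ O.toSubring), A.toSubring ≤ T → (subringCentre T O hT).IsMaximal) →
    ∀ g₀ : K, (∀ c : K, c ^ p ≠ g₀) →
    ∃ (A' : Subalgebra k K), A'.toSubring ≤ O.toSubring ∧ A ≤ A' ∧ A'.FG ∧
    ∃ (_ : IsRegularLocalRing (locAtCentre A'.toSubring O)) (c : Fin p → K), (∃ j : Fin p, (j : ℕ) ≠ 0 ∧ c j ≠ 0) ∧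
    ((∃ (d m : ℕ) (hmd : m ≤ d) (t : Fin d → ↥(locAtCentre A'.toSubring O)) (a : Fin m → ℕ) (u : ↥(locAtCentre A'.toSubring O)), IsUnit u ∧
    Ideal.span (Set.range t) = IsLocalRing.maximalIdeal ↥(locAtCentre A'.toSubring O) ∧
    ringKrullDim ↥(locAtCentre A'.toSubring O) = (d : WithBot ℕ∞) ∧ 0 < m ∧ (∀ i, ¬ p ∣ a i) ∧
    (∑ j : Fin p, c j ^ p * g₀ ^ (j : ℕ)) = (u : K) * ∏ i : Fin m, ((t (Fin.castLE hmd i) : ↥(locAtCentre A'.toSubring O)) : K) ^ (a i)) ∨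
    (∃ u : ↥(locAtCentre A'.toSubring O), IsUnit u ∧ (∑ j : Fin p, c j ^ p * g₀ ^ (j : ℕ)) = (u : K) ∧
    ∀ c' : ↥(locAtCentre A'.toSubring O), u - c' ^ p ∉ IsLocalRing.maximalIdeal ↥(locAtCentre A'.toSubring O)) ∨
    (∃ s c' : ↥(locAtCentre A'.toSubring O), (∑ j : Fin p, c j ^ p * g₀ ^ (j : ℕ)) = (s : K) ∧
    s - c' ^ p ∈ IsLocalRing.maximalIdeal ↥(locAtCentre A'.toSubring O) ∧
    s - c' ^ p ∉ IsLocalRing.maximalIdeal ↥(locAtCentre A'.toSubring O) ^ 2)) := by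
  intro p hp k _ _ K _ _ O A hAO hAfg hfrac hdimA hreg hdim3 hzd g₀ hg₀
  by_cases hp2 : p = 2
  · exact Lens5.PTwo.cleanLU3_of_eq_two_of_phaseTwo hBS2 p hp hp2 k K O A hAO hAfg hfrac hdimA hreg hdim3 hzd g₀ hg₀
  by_cases hbest : ∃ f₀ : K, ∀ f : K, O.valuation (g₀ - f₀ ^ p) ≤ O.valuation (g₀ - f ^ p)
  · obtain ⟨f₀, hf₀⟩ := hbest
    exact cleanLU3_of_isMin_pthPowerApprox_of_thm11 h11 p hp k K O A hAO hAfg hfrac hreg hdim3 g₀ hg₀ f₀ hf₀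
  · push Not at hbest
    have hk : ∀ c : k, algebraMap k K c ∈ O := fun c => hAO (A.algebraMap_mem c)
    by_cases htd : transcendenceDefect k O hk = 0
    · exact cleanLU3_of_transcendenceDefect_eq_zero_of_thm11 h11 p hp k K O A hAO hAfg hfrac hreg hdim3 g₀ hg₀ hk htd
    · have htd' : ∀ hk' : ∀ c : k, algebraMap k K c ∈ O, transcendenceDefect k O hk' ≠ 0 :=
        fun hk' => (by exact htd : transcendenceDefect k O hk ≠ 0)
      by_cases hdisc : (∃ π : K, π ≠ 0 ∧ (∀ x : K, O.valuation x < 1 → O.valuation x ≤ O.valuation π) ∧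
          (∀ x : K, x ≠ 0 → ∃ n : ℕ, O.valuation π ^ n ≤ O.valuation x))
      · exact cleanLU3DefectArc_of_discrete p hp k K O A hAO hAfg hfrac hdimA hreg hdim3 hzd g₀ hg₀ hbest htd' hdisc
      · exact cleanLU3DefectNonDiscrete_of_inputs (hCR := hCR) (hB := hB) (h11 := h11) p hp hp2 k K O A hAO hAfg hfrac hdimA hreg hdim3 hzd g₀
          hg₀ hbest htd' hdisc

include hBS2 hB h44c in
/-- **The crux `RadicialJung.CleanModels` RESTRICTED TO `dim W ≤ 3`** from the three printed inputs `CP2019.CossartPiltant2019Thm11` /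
`Cossart1987ThmRational` / wi-91399 at `p = 2` and the two research statements `hB` (class (B)) and `h44c` (X44c).  NEW w.r.t. the twin file: the node
OPENS with `by_cases IsAlgClosed k`, the algebraically closed case being ONE `exact` on ✓ `KbarQuasiProjective.cleanModels_algClosed_dimLEThree_of_cossartRational`
(every regular `W`, `dim W ≤ 3`, from `Cossart1987ThmRational` ALONE — no local uniformization, no patching); otherwise as in the twin: `dim W ≤ 2` by F-75c
(✓ `stub_stacks0BICLocus`, ✓ `cleanModels_dimLETwo_of_f75c`); `dim W = 3` by the landed patching chain for clean pairs — ✓ `stub_cleanGlobalization3` over ✓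
`cleanCharts3_of_cleanLU3ZeroDim (cleanLU3_of_inputs …)` and ✓ `stub_cleanTwoModelPatching3` over ✓
`stub_cleanPrincipalization3_of_cleanPermissiblePrincipalization (cleanPermissiblePrincipalization3_of_cleanProp44 h44c) stub_cleanPointBlowup`, fed to ✓
`cleanModelsDimThree_of_logCleanPrincipalizationDimThree`.
[cite: CossartPiltant2019, Thm. 1.1] [cite: Posva2024, Claim 5.1.2 and App. A §A.7] -/
theorem cleanModels_dimLEThree_of_inputs (h11 : CP2019.CossartPiltant2019Thm11.{0}) (hCR : Cossart1987ThmRational) :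
    ∀ p : ℕ, p.Prime → ∀ (k : Type) [Field k] [CharP k p] (W : AlgebraicGeometry.Scheme.{0}) [AlgebraicGeometry.IsIntegral W]
      (f : W ⟶ AlgebraicGeometry.Spec (.of k)) (L : Type) [Field L] [Algebra W.functionField L],
      AlgebraicGeometry.IsSeparated f → AlgebraicGeometry.LocallyOfFiniteType f → AlgebraicGeometry.QuasiCompact f →
      Literature.AlgebraicGeometry.Resolution.Scheme.IsRegular W → IsPurelyInseparable W.functionField L →
      Module.finrank W.functionField L = p → topologicalKrullDim W ≤ 3 →
      ∃ (V : AlgebraicGeometry.Scheme.{0}) (π : V ⟶ W) (_ : AlgebraicGeometry.IsIntegral V) (_ : AlgebraicGeometry.IsDominant π),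
        AlgebraicGeometry.IsProper π ∧ Literature.AlgebraicGeometry.Resolution.IsBirational π ∧
        Literature.AlgebraicGeometry.Resolution.Scheme.IsRegular V ∧ (∀ v : V, (∃ (y : L) (g : W.functionField),
          y ∉ Set.range (algebraMap W.functionField L) ∧ algebraMap W.functionField L g = y ^ p ∧
          ((∃ (d m : ℕ) (hmd : m ≤ d) (t : Fin d → V.presheaf.stalk v) (a : Fin m → ℕ),
              Ideal.span (Set.range t) = IsLocalRing.maximalIdeal (V.presheaf.stalk v) ∧
              ringKrullDim (V.presheaf.stalk v) = (d : WithBot ℕ∞) ∧ 0 < m ∧ (∀ i, ¬ p ∣ a i) ∧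
              Literature.AlgebraicGeometry.Motives.RatFn.functionFieldMap π g =
                ∏ i : Fin m, (algebraMap (V.presheaf.stalk v) V.functionField (t (Fin.castLE hmd i))) ^ (a i)) ∨
            (∃ u₀ : V.presheaf.stalk v, IsUnit u₀ ∧
              Literature.AlgebraicGeometry.Motives.RatFn.functionFieldMap π g = algebraMap (V.presheaf.stalk v) V.functionField u₀ ∧
              ((∀ c : V.presheaf.stalk v, u₀ - c ^ p ∉ IsLocalRing.maximalIdeal (V.presheaf.stalk v)) ∨
                (∃ c : V.presheaf.stalk v, u₀ - c ^ p ∈ IsLocalRing.maximalIdeal (V.presheaf.stalk v) ∧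
                  u₀ - c ^ p ∉ IsLocalRing.maximalIdeal (V.presheaf.stalk v) ^ 2)))))) := by
  intro p hp k _ _ W _ f L _ _ hs hl hq hr hpi hd h3
  by_cases halg : IsAlgClosed k
  · exact KbarQuasiProjective.cleanModels_algClosed_dimLEThree_of_cossartRational hCR p hp k W f L hs hl hq hr hpi hd halg h3
  by_cases h2 : topologicalKrullDim W ≤ 2
  · haveI := hs; haveI := hl; haveI := hq; haveI := hpi
    exact cleanModels_dimLETwo_of_f75c stub_stacks0BICLocus p hp k W f hr L hd h2
  · exact cleanModelsDimThree_of_logCleanPrincipalizationDimThree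
      (stub_cleanGlobalization3 (cleanCharts3_of_cleanLU3ZeroDim (cleanLU3_of_inputs (hCR := hCR) (hBS2 := hBS2) (hB := hB) (h11 := h11)))
        (stub_cleanTwoModelPatching3
          (stub_cleanPrincipalization3_of_cleanPermissiblePrincipalization
            (cleanPermissiblePrincipalization3_of_cleanProp44 h44c) stub_cleanPointBlowup)))
      p hp k W f L hs hl hq hr hpi hd h2 h3

include hBS2 hB h44c hGE4 in
/-- **The crux `Theses.RadicialJung.CleanModels` BY NAME from SIX inputs** (the merged hand-1 reshape of Sketch rev 35, g0 + g23): THREE PRINTED facts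
(`CP2019.CossartPiltant2019Thm11` = CP 2019 Thm. 1.1 (i)(ii)(iii) verbatim, `Cossart1987ThmRational` = Cossart 1987 / Posva 2024 Claim 5.1.2, wi-91399 at
`p = 2`), two RESEARCH statements (`hB` class (B), `h44c` X44c — both now consumed only over NON-algebraically-closed ground fields) and the FRONTIER statement
`hGE4` (`dim W ≥ 4`) — cases on `topologicalKrullDim W ≤ 3`.  A CONDITIONAL packaging of the line's reduction, not a proof of the crux.
[cite: CossartPiltant2019, Thm. 1.1] [cite: Posva2024, Claim 5.1.2 and App. A §A.7] -/
theorem cleanModels_of_inputs (h11 : CP2019.CossartPiltant2019Thm11.{0}) (hCR : Cossart1987ThmRational) :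
    Summit.ResolutionOfSingularities.ResolutionOfSingularities.Theses.RadicialJung.CleanModels := by
  intro p hp k _ _ W _ f L _ _ hs hl hq hr hpi hd
  by_cases h3 : topologicalKrullDim W ≤ 3
  exacts [cleanModels_dimLEThree_of_inputs (hCR := hCR) (hBS2 := hBS2) (hB := hB) (h44c := h44c) (h11 := h11) p hp k W f L hs hl hq hr hpi hd h3, hGE4 p hp k W f L hs hl hq hr hpi hd h3]

include hB h44c hGE4 in
/-- **The crux from THREE NAMED PRINTED FACTS** `CP2019.CossartPiltant2019Thm11` · `Cossart1987ThmRational` · `CossartPiltant2019_thm_1_5_i_baseSidePhase` (wi-91399,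
every `p`; ✓ `Lens5.PTwo.baseSidePhaseTwo_of_cp2019`) and `hB` / `h44c` / `hGE4`. [cite: CossartPiltant2019, Thm. 1.1 and Thm. 1.5 (i)] [cite: Posva2024, Claim 5.1.2] -/
theorem cleanModels_of_namedInputs (h11 : CP2019.CossartPiltant2019Thm11.{0}) (hCR : Cossart1987ThmRational)
    (hBS : CossartPiltant2019_thm_1_5_i_baseSidePhase.{0}) :
    Summit.ResolutionOfSingularities.ResolutionOfSingularities.Theses.RadicialJung.CleanModels :=
  cleanModels_of_inputs (hCR := hCR) (hBS2 := Lens5.PTwo.baseSidePhaseTwo_of_cp2019 hBS) (hB := hB) (h44c := h44c)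
    (hGE4 := hGE4) (h11 := h11)

include hGE4 in
/-- **Over an ALGEBRAICALLY CLOSED ground field the crux (every dimension) rests on `Cossart1987ThmRational` and the frontier statement ALONE**: the
conclusion of `Theses.RadicialJung.CleanModels` for `(p, k, W, f, L)` with the crux's binders VERBATIM plus `IsAlgClosed k`, from `hCR` (`dim W ≤ 3`, ✓
`KbarQuasiProjective.cleanModels_algClosed_dimLEThree_of_cossartRational`) and `hGE4` (`dim W ≥ 4`) — none of `h11`, `hBS2`, `hB`, `h44c` is a hypothesis
of this theorem.  The INPUT LEDGER BY CELL of the module docstring, `k = k̄` column. [cite: Posva2024, Claim 5.1.2 and App. A §A.7] [cite: Cossart1987, main theorem] -/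
theorem cleanModels_algClosed_of_inputs (hCR : Cossart1987ThmRational) :
    ∀ p : ℕ, p.Prime → ∀ (k : Type) [Field k] [CharP k p] (W : AlgebraicGeometry.Scheme.{0}) [AlgebraicGeometry.IsIntegral W]
      (f : W ⟶ AlgebraicGeometry.Spec (.of k)) (L : Type) [Field L] [Algebra W.functionField L], AlgebraicGeometry.IsSeparated f →
      AlgebraicGeometry.LocallyOfFiniteType f → AlgebraicGeometry.QuasiCompact f → Literature.AlgebraicGeometry.Resolution.Scheme.IsRegular W →
      IsPurelyInseparable W.functionField L → Module.finrank W.functionField L = p → IsAlgClosed k →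
      ∃ (V : AlgebraicGeometry.Scheme.{0}) (π : V ⟶ W) (_ : AlgebraicGeometry.IsIntegral V) (_ : AlgebraicGeometry.IsDominant π), AlgebraicGeometry.IsProper π ∧
      Literature.AlgebraicGeometry.Resolution.IsBirational π ∧ Literature.AlgebraicGeometry.Resolution.Scheme.IsRegular V ∧ (∀ v : V, (∃ (y : L) (g : W.functionField),
      y ∉ Set.range (algebraMap W.functionField L) ∧ algebraMap W.functionField L g = y ^ p ∧ ((∃ (d m : ℕ) (hmd : m ≤ d) (t : Fin d → V.presheaf.stalk v) (a : Fin m → ℕ),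
      Ideal.span (Set.range t) = IsLocalRing.maximalIdeal (V.presheaf.stalk v) ∧ ringKrullDim (V.presheaf.stalk v) = (d : WithBot ℕ∞) ∧ 0 < m ∧ (∀ i, ¬ p ∣ a i) ∧
      Literature.AlgebraicGeometry.Motives.RatFn.functionFieldMap π g = ∏ i : Fin m, (algebraMap (V.presheaf.stalk v) V.functionField (t (Fin.castLE hmd i))) ^ (a i)) ∨
      (∃ u₀ : V.presheaf.stalk v, IsUnit u₀ ∧ Literature.AlgebraicGeometry.Motives.RatFn.functionFieldMap π g = algebraMap (V.presheaf.stalk v) V.functionField u₀ ∧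
      ((∀ c : V.presheaf.stalk v, u₀ - c ^ p ∉ IsLocalRing.maximalIdeal (V.presheaf.stalk v)) ∨ (∃ c : V.presheaf.stalk v,
      u₀ - c ^ p ∈ IsLocalRing.maximalIdeal (V.presheaf.stalk v) ∧ u₀ - c ^ p ∉ IsLocalRing.maximalIdeal (V.presheaf.stalk v) ^ 2)))))) := by
  intro p hp k _ _ W _ f L _ _ hs hl hq hr hpi hd halg
  by_cases h3 : topologicalKrullDim W ≤ 3
  exacts [KbarQuasiProjective.cleanModels_algClosed_dimLEThree_of_cossartRational hCR p hp k W f L hs hl hq hr hpi hd halg h3, hGE4 p hp k W f L hs hl hq hr hpi hd h3]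

end Inputs

end Summit.ResolutionOfSingularities.ResolutionOfSingularities.Theorems.RadicialJung.CleanModels.OfInputsRational

end
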